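import Summits.ResolutionOfSingularities.ResolutionOfSingularities.Theorems.PurelyInseparableDim4ChartAtlasSNCLocalBase
import Summits.ResolutionOfSingularities.ResolutionOfSingularities.Theorems.PurelyInseparableDim4ChartAtlasSNCDisjointRepairs
import HarnessLib

/-!
# Purely inseparable four-folds `z^p + F(x₁, …, x₄)`: ADMISSIBILITY OF A STRICT TRANSFORM FROM A MODEL OVER THE CENTRE AND FROM THE OLD
# ADMISSIBILITY OFF THE CENTRE (cell `res-dim4-pi`, typ-2 g7; HANDOFF OPEN 4 «transport of the far repair to the walk's stage objects»,
# generic half, second form)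

[OURS · counted 0] (D-0157 DOOR 2; DR-157-C.) p718958 (`admissible_strictTransform_of_model`) transports the chart-model repair theorems to a
stage `W` when the centre to be made admissible lies INSIDE the chart, `V(Z) ⊆ φ(V)`. The escaping global centre `Zc` of the S3-N1 atlas does
not (it is covered by the `x_j`-chart AND the shear charts, p688180), but the REPAIR CENTRE does: `V(C) ⊆ φ(V)`. This file is the form needed
there, for any locally Noetherian `W`, open immersion `φ : V → W`, ideal sheaves `C` (`V(C) ⊆ φ(V)`), `Z`, marked ideal `M = (W, 𝓘, E, μ)`
with `E` snc with `C`, and ANY blowing up `τ : W′ → W` along `C`. PROVED here (no `sorry`, no new axiom):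

* `hasSNCWith_strictTransform_offCentre`, `isRegular_strictTransform_offCentre`, `support_strictTransform_offCentre` — ON THE PIECE
  `τ⁻¹(W ∖ V(C))` (an open immersion `g` into `W`, Literature `IsBlowup.isOpenImmersion_preimage_compl_ι`) the strict transform of `Z` is
  `g^*Z`, the transformed boundary is `E.map g^* ++ [⊤]` (p716496 `strictTransformIdeal_comap_ι_preimage_centreCompl`,
  `comap_comap_ι_preimage_centreCompl_eq_top`), so the OLD admissibility of `Z` — `V(Z)` regular, `V(Z) ⊆ supp M`, and `Z` snc with a
  sub-boundary `E₀` whose complement in `E` meets `V(Z)` only inside `V(C)` — restricts to it (Literature `HasSNCWith.of_disjoint`,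
  `IsBlowup.mem_support_transform_iff_of_not_mem`);
* **`admissible_strictTransform_of_model_offCentre`** — THE TRANSPORT: the chart-model triple for EVERY blowing up of `V` along `φ^*C` (the
  shape delivered by p709208 / p718023 / p718376 / p719034 / `…SNCFarRepairHeights`) over `φ(V)`, plus the old admissibility of `Z` off
  `V(C)` as above, give: `C' = St_τ(Z)` is REGULAR, `V(C') ⊆ supp(M.transform τ C)`, and `HasSNCWith (M.transform τ C).boundary C'` on `W′`
  (glue p692083 over the two pieces `τ⁻¹(φ(V)) ∪ τ⁻¹(W ∖ V(C)) = W′`).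

Nothing here is a statement about resolution of singularities in dimension ≥ 4 / characteristic `p` (NOT proved anywhere in this programme).
bears_on: LADDER-RESOLUTION:D157-DOOR2 (res-dim4-pi). Supports stmt-ResolutionOfSingularities-16155 (helper).
-/

-- every declaration of this summit lives under `Summit.ResolutionOfSingularities.ResolutionOfSingularities`
-- (summit = problem), which the duplicate-namespace linter flags; house convention (cf. the Target file).
set_option linter.dupNamespace false

noncomputable section

open CategoryTheory AlgebraicGeometry TopologicalSpace

namespace Summit.ResolutionOfSingularities.ResolutionOfSingularities.Theorems.PIDim4

open Literature.AlgebraicGeometry.Resolution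

namespace ChartDictionary

universe u

variable {W W' : Scheme.{u}} [IsLocallyNoetherian W] {C Z : W.IdealSheafData} {τ : W' ⟶ W}

/-! ## §1 Off the centre the old admissibility survives -/

/-- **OFF THE CENTRE, THE STRICT TRANSFORM IS SNC WITH THE TRANSFORMED BOUNDARY IF `Z` WAS SNC WITH A SUB-BOUNDARY `E₀`** whose complement in
`E` meets `V(Z)` only inside `V(C)`: on the piece `τ⁻¹(W ∖ V(C))`. -/
theorem hasSNCWith_strictTransform_offCentre (hτ : IsBlowup τ C) {E E₀ : List W.IdealSheafData} (hEC : HasSNCWith E C)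
    (hZ : HasSNCWith E₀ Z) (hd : ∀ D ∈ E, D ∉ E₀ → (D.support : Set W) ∩ Z.support ⊆ C.support) :
    HasSNCWith ((E.map (strictTransformIdeal τ C) ++ [C.comap τ]).map (·.comap (τ ⁻¹ᵁ centreCompl C).ι))
      ((strictTransformIdeal τ C Z).comap (τ ⁻¹ᵁ centreCompl C).ι) := by
  classical
  haveI : IsProper τ := hτ.isProper
  haveI : IsLocallyNoetherian W' := LocallyOfFiniteType.isLocallyNoetherian τ
  haveI : IsOpenImmersion ((τ ⁻¹ᵁ centreCompl C).ι ≫ τ) := hτ.isOpenImmersion_preimage_compl_ι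
  rw [strictTransformIdeal_comap_ι_preimage_centreCompl hτ, ← Scheme.IdealSheafData.comap_comp]
  refine HasSNCWith.of_disjoint (E' := E₀.map (·.comap ((τ ⁻¹ᵁ centreCompl C).ι ≫ τ)))
    (hZ.comap_of_isOpenImmersion ((τ ⁻¹ᵁ centreCompl C).ι ≫ τ)) ?_ ?_
  · have h := (hEC.hasSNC_transform hτ).comap_of_isOpenImmersion (τ ⁻¹ᵁ centreCompl C).ι
    rwa [Scheme.IdealSheafData.comap_top] at h
  · intro D' hD' hD'E'
    rw [List.map_append, List.mem_append, List.map_map, List.mem_map, List.map_singleton, List.mem_singleton] at hD'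
    rcases hD' with ⟨D, hD, rfl⟩ | rfl
    · simp only [Function.comp_apply] at hD'E' ⊢
      rw [strictTransformIdeal_comap_ι_preimage_centreCompl hτ, ← Scheme.IdealSheafData.comap_comp] at hD'E' ⊢
      by_cases hDE₀ : D ∈ E₀
      · exact absurd (List.mem_map.mpr ⟨D, hDE₀, rfl⟩) hD'E'
      · refine Set.eq_empty_iff_forall_notMem.mpr fun u hu => ?_
        have h1 : ((τ ⁻¹ᵁ centreCompl C).ι ≫ τ) u ∈ D.support := (mem_support_comap_iff _ _ u).mp hu.1
        have h2 : ((τ ⁻¹ᵁ centreCompl C).ι ≫ τ) u ∈ Z.support := (mem_support_comap_iff _ _ u).mp hu.2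
        have h3 := hd D hD hDE₀ ⟨h1, h2⟩
        rw [Scheme.Hom.comp_apply] at h3
        have hu' : τ ((τ ⁻¹ᵁ centreCompl C).ι u) ∉ (C.support : Set W) := u.2
        exact hu' h3
    · rw [comap_comap_ι_preimage_centreCompl_eq_top]
      refine Set.eq_empty_iff_forall_notMem.mpr fun u hu => ?_
      have h := hu.1
      rw [SetLike.mem_coe, Scheme.IdealSheafData.support_top] at h
      exact h

/-- **OFF THE CENTRE, THE STRICT TRANSFORM OF A REGULAR `V(Z)` IS REGULAR.** -/
theorem isRegular_strictTransform_offCentre (hτ : IsBlowup τ C) (hZ : Scheme.IsRegular Z.subscheme) :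
    Scheme.IsRegular ((strictTransformIdeal τ C Z).comap (τ ⁻¹ᵁ centreCompl C).ι).subscheme := by
  haveI : IsProper τ := hτ.isProper
  haveI : IsLocallyNoetherian W' := LocallyOfFiniteType.isLocallyNoetherian τ
  haveI : IsOpenImmersion ((τ ⁻¹ᵁ centreCompl C).ι ≫ τ) := hτ.isOpenImmersion_preimage_compl_ι
  rw [strictTransformIdeal_comap_ι_preimage_centreCompl hτ, ← Scheme.IdealSheafData.comap_comp]
  exact hZ.subscheme_comap_of_isOpenImmersion _

/-- **OFF THE CENTRE, `V(St_τ Z) ⊆ supp(M.transform τ C)` IF `V(Z) ⊆ supp M`.** -/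
theorem support_strictTransform_offCentre (hτ : IsBlowup τ C) (M : MarkedIdeal W) (hZ : (Z.support : Set W) ⊆ M.support) :
    (((strictTransformIdeal τ C Z).comap (τ ⁻¹ᵁ centreCompl C).ι).support :
        Set ((τ ⁻¹ᵁ centreCompl C : W'.Opens) : Scheme.{u})) ⊆
      (τ ⁻¹ᵁ centreCompl C).ι ⁻¹' (M.transform τ C).support := by
  haveI : IsProper τ := hτ.isProper
  haveI : IsLocallyNoetherian W' := LocallyOfFiniteType.isLocallyNoetherian τ
  intro u hu
  rw [strictTransformIdeal_comap_ι_preimage_centreCompl hτ, ← Scheme.IdealSheafData.comap_comp] at hu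
  have hu' : τ ((τ ⁻¹ᵁ centreCompl C).ι u) ∉ (C.support : Set W) := u.2
  have h := hZ ((mem_support_comap_iff _ _ u).mp hu)
  rw [Scheme.Hom.comp_apply] at h
  exact (hτ.mem_support_transform_iff_of_not_mem M hu').mpr h

/-! ## §2 The transport -/

/-- **ADMISSIBILITY OF A STRICT TRANSFORM FROM A MODEL OVER THE CENTRE AND THE OLD ADMISSIBILITY OFF THE CENTRE.** `W` locally Noetherian,
`φ : V → W` an open immersion, `C` (`V(C) ⊆ φ(V)`), `Z` ideal sheaves on `W`, `M = (W, 𝓘, E, μ)` with `E` snc with `C`. MODEL: for every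
blowing up `τ_V` of `V` along `φ^*C`, the strict transform of `φ^*Z` is regular, inside `supp((φ^*M).transform τ_V (φ^*C))`, and snc with
`(E.map φ^*).map St ++ [exc]`. OFF THE CENTRE: `V(Z)` regular, `V(Z) ⊆ supp M`, `Z` snc with a sub-boundary `E₀` whose complement in `E` meets
`V(Z)` only inside `V(C)`. Then for every blowing up `τ : W′ → W` along `C`: `C' = St_τ(Z)` is REGULAR, `V(C') ⊆ supp(M.transform τ C)`, and
`HasSNCWith (M.transform τ C).boundary C'`. -/
theorem admissible_strictTransform_of_model_offCentre {V : Scheme.{u}} (φ : V ⟶ W) [IsOpenImmersion φ] (M : MarkedIdeal W)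
    (hC : (C.support : Set W) ⊆ Set.range φ) (hEC : HasSNCWith M.boundary C)
    (hV : ∀ ⦃V' : Scheme.{u}⦄ ⦃τV : V' ⟶ V⦄, IsBlowup τV (C.comap φ) →
      Scheme.IsRegular (strictTransformIdeal τV (C.comap φ) (Z.comap φ)).subscheme ∧
      ((strictTransformIdeal τV (C.comap φ) (Z.comap φ)).support : Set V') ⊆
        ((⟨M.ideal.comap φ, M.boundary.map (·.comap φ), M.mult⟩ : MarkedIdeal V).transform τV (C.comap φ)).support ∧
      HasSNCWith ((M.boundary.map (·.comap φ)).map (strictTransformIdeal τV (C.comap φ)) ++ [(C.comap φ).comap τV])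
        (strictTransformIdeal τV (C.comap φ) (Z.comap φ)))
    (hZreg : Scheme.IsRegular Z.subscheme) (hZsupp : (Z.support : Set W) ⊆ M.support) {E₀ : List W.IdealSheafData}
    (hZsnc : HasSNCWith E₀ Z) (hd : ∀ D ∈ M.boundary, D ∉ E₀ → (D.support : Set W) ∩ Z.support ⊆ C.support)
    (hτ : IsBlowup τ C) :
    let M' := M.transform τ C
    let C' := strictTransformIdeal τ C Z
    Scheme.IsRegular C'.subscheme ∧ (C'.support : Set W') ⊆ M'.support ∧ HasSNCWith M'.boundary C' := by
  intro M' C'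
  haveI : IsProper τ := hτ.isProper
  haveI : IsLocallyNoetherian W' := LocallyOfFiniteType.isLocallyNoetherian τ
  -- the model over `φ(V)`
  obtain ⟨hreg, hsupp, hsnc⟩ := hV (isBlowup_morphismRestrict_comp_isoOpensRange_inv φ hτ)
  rw [strictTransformIdeal_model] at hreg hsupp hsnc
  rw [transformBoundary_model] at hsnc
  -- the two pieces cover `W′`
  let Uo : Bool → W'.Opens := fun bb => bif bb then τ ⁻¹ᵁ φ.opensRange else τ ⁻¹ᵁ centreCompl C
  have hcov : (C'.support : Set W') ⊆ ⋃ bb : Bool, Set.range (Uo bb).ι := fun x _ => by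
    by_cases hx : τ x ∈ Set.range φ
    · refine Set.mem_iUnion.mpr ⟨true, ?_⟩
      rw [Scheme.Opens.range_ι]
      exact hx
    · refine Set.mem_iUnion.mpr ⟨false, ?_⟩
      rw [Scheme.Opens.range_ι]
      show τ x ∉ (C.support : Set W)
      exact fun h => hx (hC h)
  refine ⟨isRegular_subscheme_of_cover_comap (fun bb => (Uo bb).ι) hcov ?_,
    support_subset_of_cover_comap (fun bb => (Uo bb).ι) hcov ?_, ?_⟩
  · rintro (_ | _)
    · exact isRegular_strictTransform_offCentre hτ hZreg
    · exact hreg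
  · rintro (_ | _)
    · exact support_strictTransform_offCentre hτ M hZsupp
    · intro x hx
      have h := hsupp hx
      change ((M.mult : ℕ) : ℕ∞) ≤ idealOrder (controlledTransform ((τ ∣_ φ.opensRange) ≫ φ.isoOpensRange.inv) (C.comap φ)
        (M.ideal.comap φ) M.mult) x at h
      rw [controlledTransform_model, idealOrder_comap_of_isOpenImmersion] at h
      exact h
  · rw [MarkedIdeal.transform_boundary]
    refine hasSNCWith_of_cover_comap (fun bb => (Uo bb).ι) (hEC.hasSNC_transform hτ) hcov ?_
    rintro (_ | _)
    · exact hasSNCWith_strictTransform_offCentre hτ hEC hZsnc hd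
    · exact hsnc

end ChartDictionary

end Summit.ResolutionOfSingularities.ResolutionOfSingularities.Theorems.PIDim4

end
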